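import Literature.NumberTheory.Transcendental.ExpDominantSolvabilityContraction
import Literature.NumberTheory.Transcendental.ExpVarieties
import Literature.ModelTheory.ExponentialFields.Languages
import Summits.Schanuel.Schanuel.Theorems.ZilberEacComplexPunctureDecouplingLemmas
import Summits.Schanuel.Schanuel.Theorems.ZilberEacComplexGraphEscapeParamLemmas
import Literature.NumberTheory.Transcendental.ExpDominantSolvabilityContraction
import Literature.NumberTheory.Transcendental.ExpVarieties
import Summits.Schanuel.Schanuel.Theorems.ZilberEacComplexPunctureDecouplingLemmas
import HarnessLib

/-!
# Escape over graph bases of any degree: rationally parametrised (Laurent) fibres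

EAC, first open rung `dim π₁(V) = n - 1` (Mantova–Masser, PLMS 129 (2024), §1 p. 5), for the
`(s+1)`-folds over the graph `x_{s+1} = g(x')` (ANY `g`, `deg g = D ≥ 2`) swept by Laurent-parametrised
fibre curves `yᵢ = Tᵢ(x') t^{νᵢ} + Σ_{m ∈ Sᵢ, m < νᵢ} A_{i,m}(x') tᵐ` for ALL `i ≤ s + 1` (`ν ∈ ℤ^{s+1}`;
the graph coordinate need NOT be the fibre parameter, e.g. `(y₁ - x₁)² = y₃`; negative powers allowed),
under the Zariski-open conditions `g_D(ν') ≠ 0`, `(Tᵢ)_{deg Tᵢ}(ν') ≠ 0`, with NO lattice hypothesis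
(Theorem H_esc needs a non-imaginary lattice root, which fails for hyperbolic leading forms such as
`x₁² - x₂²` in timelike directions). Theorem E_D^top is the case `y_{s+1} = t`. Mechanism: sub-linear
escape `τ = e^Λ`, the `(s+1)`-st fibre equation absorbed into the base equation
`g(x') = ν_{s+1}τ + d_{s+1}Λ + log t_{s+1} + log(1 + G_{s+1}) + 2πiσk` via a holomorphic logarithm.
* `exists_expPoint_graphEscape_param` — **EC for the class above** (Theorem E_D^par).
HONEST FRAMING: a modest new sub-rung of EAC; nothing here bears on Schanuel's conjecture.
-/

noncomputable section

open Complex MvPolynomial Metric Set Filter Topology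

set_option linter.dupNamespace false

namespace Summit.Schanuel.Schanuel.Theorems

set_option maxHeartbeats 1600000 in
/-- **Escape over a graph base of any degree, Laurent-parametrised fibres (Theorem E_D^par).** Let
`g ∈ ℂ[x₁..xₛ]` have total degree `D ≥ 2`; `ν ∈ ℤ^{s+1}` with `g_D(ν') ≠ 0` (`ν'ⱼ = νⱼ`, `j ≤ s`);
`Tᵢ ∈ ℂ[x']` with `(Tᵢ)_{deg Tᵢ}(ν') ≠ 0`; `Sᵢ ⊆ ℤ` finite below `νᵢ`; `A_{i,m} ∈ ℂ[x']` arbitrary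
(`i ≤ s+1`). Then there are `x' ∈ ℂˢ` and `L ∈ ℂ` with, writing `x_{s+1} = g(x')`,
`e^{xᵢ} = Tᵢ(x') e^{νᵢL} + Σ_{m ∈ Sᵢ} A_{i,m}(x') e^{mL}` for ALL `i ≤ s + 1`: the `(s+1)`-fold swept over
the graph by the fibre curves `yᵢ = Tᵢ t^{νᵢ} + Σ A_{i,m} tᵐ` (`dim π₁ V = n - 1`, Mantova–Masser 2024 §1
p. 5) meets the graph of `exp`; no lattice hypothesis; generalizes Theorem E_D^top (`y_{s+1} = t`).
New. [cite: MantovaMasser2023, §1 p.5 (the open case dim π(V) = 2 in ℂ³×ℂˣ³)] -/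
theorem exists_expPoint_graphEscape_param {s : ℕ} (g : MvPolynomial (Fin s) ℂ)
    (hD : 2 ≤ g.totalDegree) (ν : Fin (s + 1) → ℤ)
    (hα : eval (fun j => (ν (Fin.castSucc j) : ℂ)) (homogeneousComponent g.totalDegree g) ≠ 0)
    (T : Fin (s + 1) → MvPolynomial (Fin s) ℂ)
    (hT : ∀ i, eval (fun j => (ν (Fin.castSucc j) : ℂ))
      (homogeneousComponent (T i).totalDegree (T i)) ≠ 0)
    (S : Fin (s + 1) → Finset ℤ) (hS : ∀ i, ∀ m ∈ S i, m < ν i)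
    (A : Fin (s + 1) → ℤ → MvPolynomial (Fin s) ℂ) :
    ∃ x : Fin s → ℂ, ∃ L : ℂ, ∀ i : Fin (s + 1),
      exp ((Fin.snoc x (eval x g) : Fin (s + 1) → ℂ) i) = eval x (T i) * exp ((ν i : ℂ) * L) +
        ∑ m ∈ S i, eval x (A i m) * exp ((m : ℂ) * L) := by
  classical
  set D := g.totalDegree with hDdef
  set κc : Fin s → ℂ := fun j => (ν (Fin.castSucc j) : ℂ) with hκc
  set α : ℂ := eval κc (homogeneousComponent D g) with hαdef
  have hαpos : 0 < ‖α‖ := norm_pos_iff.mpr hα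
  have hD0 : D ≠ 0 := by omega
  have hDC : (D : ℂ) ≠ 0 := by exact_mod_cast hD0
  set d : Fin (s + 1) → ℕ := fun i => (T i).totalDegree with hd
  set t : Fin (s + 1) → ℂ := fun i => eval κc (homogeneousComponent (d i) (T i)) with ht
  have ht0 : ∀ i, t i ≠ 0 := fun i => hT i
  set ℓ : Fin (s + 1) → ℂ := fun i => log (t i) with hℓ
  have hexpℓ : ∀ i, exp (ℓ i) = t i := fun i => Complex.exp_log (ht0 i)
  obtain ⟨σ, hσ, θ₀, hθ₀, hroot⟩ := exists_sign_arg_root hα (Nat.pos_of_ne_zero hD0)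
  obtain ⟨Cg, hCg0, Ng, hCg⟩ := exists_norm_eval_ray_sub_le g κc
  have hrayT := fun i => exists_norm_eval_ray_sub_le (T i) κc
  choose CT hCT0 NT hCT using hrayT
  have hgrowth := fun i m =>
    Literature.NumberTheory.Transcendental.HypersurfaceCover.exists_norm_eval_le_pow (A i m)
  choose CA hCA0 NA hCA using hgrowth
  set ε : ℝ := 1 / (16 * ((s : ℝ) + 2)) with hε
  have hεpos : 0 < ε := by positivity
  have hε12 : ε ≤ 1 / 2 := by rw [hε, div_le_div_iff₀ (by positivity) (by norm_num)]; nlinarith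
  set c₁ : ℝ := ∑ i, (d i : ℝ) with hc₁
  have hc₁0 : 0 ≤ c₁ := by positivity
  have hdc₁ : ∀ i, (d i : ℝ) ≤ c₁ := fun i =>
    Finset.single_le_sum (f := fun i => (d i : ℝ)) (fun i _ => by positivity) (Finset.mem_univ i)
  set c₂ : ℝ := c₁ * (Real.pi + 1) + ‖ℓ‖ + 1 with hc₂
  have hc₂0 : 0 ≤ c₂ := by positivity
  set W : ℝ → ℝ := fun r => c₁ * Real.log r + c₂ with hW
  set L : ℝ := 2 * ‖κc‖ + c₁ + c₂ + 1 with hL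
  have hL0 : 0 ≤ L := by positivity
  set νn : ℝ := |(ν (Fin.last s) : ℝ)| with hνn
  set F : Fin (s + 1) → ℝ → ℝ := fun i r =>
    (CT i * (2 ^ d i * 2 ^ d i) * ((1 + c₁ * Real.log r + c₂) ^ NT i / r) +
      2 ^ d i * ∑ m ∈ S i,
        CA i m * L ^ NA i m * ((1 + r) ^ NA i m * Real.exp (-(r / 12)))) / ‖t i‖ with hF
  set Fl : ℝ → ℝ := fun r =>
    ((2 * νn + 1) * ((1 + c₁ * Real.log r + c₂) ^ 1 / r) +
      Cg * 2 ^ (D - 1) * ((1 + c₁ * Real.log r + c₂) ^ Ng / r)) / ‖α‖ with hFl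
  have hFt : ∀ i, Tendsto (F i) atTop (𝓝 0) := by
    intro i
    have h1 := tendsto_finsetSum (S i) fun m _ =>
      (tendsto_one_add_pow_mul_exp_neg_div (NA i m)).const_mul (CA i m * L ^ NA i m)
    simp only [mul_zero, Finset.sum_const_zero] at h1
    have h2 := ((tendsto_one_add_log_pow_div hc₁0 hc₂0 (NT i)).const_mul
      (CT i * (2 ^ d i * 2 ^ d i))).add (h1.const_mul (2 ^ d i))
    rw [mul_zero, mul_zero, add_zero] at h2
    simpa only [zero_div] using h2.div_const ‖t i‖
  have hFlt : Tendsto Fl atTop (𝓝 0) := by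
    have h2 := ((tendsto_one_add_log_pow_div hc₁0 hc₂0 1).const_mul (2 * νn + 1)).add
      ((tendsto_one_add_log_pow_div hc₁0 hc₂0 Ng).const_mul (Cg * 2 ^ (D - 1)))
    rw [mul_zero, mul_zero, add_zero] at h2
    simpa only [zero_div] using h2.div_const ‖α‖
  have hev : ∀ᶠ r : ℝ in atTop, ((∀ i, F i r ≤ ε) ∧ Fl r ≤ ε) ∧ 2 ≤ r := by
    refine ((eventually_all.2 fun i => ?_).and ?_).and (eventually_ge_atTop _)
    · exact (hFt i).eventually (ge_mem_nhds hεpos)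
    · exact hFlt.eventually (ge_mem_nhds hεpos)
  obtain ⟨R, hR⟩ := Filter.eventually_atTop.mp hev
  obtain ⟨k, hk0, hRr⟩ := exists_nat_escape_radius hαpos hD0 R
  set r : ℝ := (2 * Real.pi * k / ‖α‖) ^ ((D : ℝ)⁻¹) with hr
  have hbase : 0 ≤ 2 * Real.pi * k / ‖α‖ := by positivity
  have hrD : r ^ D = 2 * Real.pi * k / ‖α‖ := Real.rpow_inv_natCast_pow hbase hD0
  obtain ⟨⟨hFε, hFlε⟩, hr2⟩ := hR r hRr
  have hrpos : 0 < r := by linarith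
  have hr0 : 0 ≤ r := hrpos.le; have hr1 : 1 ≤ r := by linarith
  have hlogr' : Real.log r ≤ r := (Real.log_le_sub_one_of_pos hrpos).trans (by linarith)
  set τ₀ : ℂ := (r : ℂ) * exp (θ₀ * I) with hτ₀
  set K₀ : ℂ := ((2 * Real.pi * k * σ : ℝ) : ℂ) * I with hK₀
  have hK₀eq : α * τ₀ ^ D = K₀ := latticeConst_eq hα hroot hrD
  have hK₀norm' : ‖K₀‖ = ‖α‖ * r ^ D := by
    rw [hK₀, latticeConst_norm hσ, hrD]; field_simp
  have hK₀pos : 0 < ‖K₀‖ := by rw [hK₀norm']; positivity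
  have hK₀0 : K₀ ≠ 0 := norm_pos_iff.mp hK₀pos
  have hexpK₀ : exp K₀ = 1 := latticeConst_exp hσ k
  set Λf : (Fin (s + 1) → ℂ) → ℂ := fun ξ =>
    (Real.log r : ℂ) + θ₀ * I + ξ (Fin.last s) * (D : ℂ)⁻¹ with hΛf
  set τf : (Fin (s + 1) → ℂ) → ℂ := fun ξ => exp (Λf ξ) with hτf
  set wf : (Fin (s + 1) → ℂ) → (Fin s → ℂ) := fun ξ j =>
    (d (Fin.castSucc j) : ℂ) * Λf ξ + ℓ (Fin.castSucc j) + ξ (Fin.castSucc j) with hwf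
  set xf : (Fin (s + 1) → ℂ) → (Fin s → ℂ) := fun ξ => τf ξ • κc + wf ξ with hxf
  set Gf : Fin (s + 1) → (Fin (s + 1) → ℂ) → ℂ := fun i ξ =>
    (eval (xf ξ) (T i) - t i * τf ξ ^ d i +
      ∑ m ∈ S i, eval (xf ξ) (A i m) * exp (((m : ℂ) - (ν i : ℂ)) * τf ξ)) *
      (t i * τf ξ ^ d i)⁻¹ with hGf
  set Ef : (Fin (s + 1) → ℂ) → ℂ := fun ξ =>
    (ν (Fin.last s) : ℂ) * τf ξ + ((d (Fin.last s) : ℂ) * Λf ξ + ℓ (Fin.last s)) +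
      log (1 + Gf (Fin.last s) ξ) with hEf
  set Gl : (Fin (s + 1) → ℂ) → ℂ := fun ξ =>
    (α * τf ξ ^ D - eval (xf ξ) g + Ef ξ) * K₀⁻¹ with hGl
  set G : Fin (s + 1) → (Fin (s + 1) → ℂ) → ℂ :=
    Fin.snoc (α := fun _ => (Fin (s + 1) → ℂ) → ℂ) (fun j => Gf (Fin.castSucc j)) Gl with hG
  have hproj : ∀ j : Fin (s + 1), Differentiable ℂ (fun ξ : Fin (s + 1) → ℂ => ξ j) :=
    fun j => differentiable_apply j
  have hΛf_diff : Differentiable ℂ Λf :=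
    ((hproj (Fin.last s)).mul_const ((D : ℂ)⁻¹)).const_add ((Real.log r : ℂ) + θ₀ * I)
  have hτf_diff : Differentiable ℂ τf := hΛf_diff.cexp
  have hτf_ne : ∀ ξ, τf ξ ≠ 0 := fun ξ => Complex.exp_ne_zero _
  have hxf_diff : ∀ i, Differentiable ℂ fun ξ => xf ξ i := fun i =>
    (hτf_diff.mul_const (κc i)).add (((hΛf_diff.const_mul (d (Fin.castSucc i) : ℂ)).add_const
      (ℓ (Fin.castSucc i))).add (hproj (Fin.castSucc i)))
  have heval_diff : ∀ p : MvPolynomial (Fin s) ℂ, Differentiable ℂ fun ξ => eval (xf ξ) p :=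
    fun p ξ => DifferentiableAt.mvPolynomial_eval p fun i => (hxf_diff i) ξ
  have hGf_diff : ∀ i, Differentiable ℂ (Gf i) := by
    intro i
    have h3 := fun m (_ : m ∈ S i) =>
      (heval_diff (A i m)).mul ((hτf_diff.const_mul ((m : ℂ) - (ν i : ℂ))).cexp)
    have h5 : Differentiable ℂ fun ξ => (t i * τf ξ ^ d i)⁻¹ :=
      ((hτf_diff.pow (d i)).const_mul (t i)).inv fun ξ =>
        mul_ne_zero (ht0 i) (pow_ne_zero _ (hτf_ne ξ))
    exact (((heval_diff (T i)).sub ((hτf_diff.pow (d i)).const_mul (t i))).add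
      (Differentiable.fun_sum h3)).mul h5
  have hball : ∀ ξ ∈ ball (0 : Fin (s + 1) → ℂ) 1, ∀ j, ‖ξ j‖ ≤ 1 := fun ξ hξ j =>
    (norm_le_pi_norm ξ _).trans (by rw [mem_ball, dist_zero_right] at hξ; exact hξ.le)
  have hτfacts : ∀ ξ ∈ ball (0 : Fin (s + 1) → ℂ) 1,
      r / 12 ≤ (τf ξ).re ∧ r / 2 ≤ ‖τf ξ‖ ∧ ‖τf ξ‖ ≤ 2 * r ∧
        ‖Λf ξ‖ ≤ Real.log r + Real.pi + 1 :=
    fun ξ hξ => escapeCoord_facts hD hθ₀ hr1 (hball ξ hξ (Fin.last s))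
  have hwj : ∀ ξ ∈ ball (0 : Fin (s + 1) → ℂ) 1, ∀ i (z : ℂ), ‖z‖ ≤ 1 →
      ‖(d i : ℂ) * Λf ξ + ℓ i + z‖ ≤ W r := by
    intro ξ hξ i z hz
    obtain ⟨-, -, -, hΛ⟩ := hτfacts ξ hξ
    have h1 : ‖(d i : ℂ) * Λf ξ‖ ≤ c₁ * (Real.log r + Real.pi + 1) := by
      rw [norm_mul, Complex.norm_natCast]
      exact mul_le_mul (hdc₁ i) hΛ (norm_nonneg _) hc₁0
    calc ‖(d i : ℂ) * Λf ξ + ℓ i + z‖ ≤ ‖(d i : ℂ) * Λf ξ‖ + ‖ℓ i‖ + ‖z‖ := norm_add₃_le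
      _ ≤ c₁ * (Real.log r + Real.pi + 1) + ‖ℓ‖ + 1 := by linarith [norm_le_pi_norm ℓ i]
      _ = W r := by simp only [hW, hc₂]; ring
  have hwbound : ∀ ξ ∈ ball (0 : Fin (s + 1) → ℂ) 1, ‖wf ξ‖ ≤ W r := by
    intro ξ hξ
    rw [pi_norm_le_iff_of_nonneg ((norm_nonneg _).trans (hwj ξ hξ 0 0 (by simp)))]
    exact fun j => hwj ξ hξ _ _ (hball ξ hξ _)
  have hW0 : 0 ≤ W r := by
    simp only [hW]; nlinarith [mul_nonneg hc₁0 (Real.log_nonneg hr1)]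
  have hWr : W r ≤ c₁ * r + c₂ := by simp only [hW]; nlinarith
  have hxbound : ∀ ξ ∈ ball (0 : Fin (s + 1) → ℂ) 1, 1 + ‖xf ξ‖ ≤ L * (1 + r) := by
    intro ξ hξ
    obtain ⟨-, -, hτ2, -⟩ := hτfacts ξ hξ
    have h1 : ‖xf ξ‖ ≤ ‖τf ξ‖ * ‖κc‖ + ‖wf ξ‖ :=
      (norm_add_le _ _).trans (add_le_add (norm_smul_le _ _) le_rfl)
    rw [hL]
    nlinarith [norm_nonneg κc, norm_nonneg (wf ξ), norm_nonneg (τf ξ), hwbound ξ hξ]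
  have hGfb : ∀ i, ∀ ξ ∈ ball (0 : Fin (s + 1) → ℂ) 1, ‖Gf i ξ‖ ≤ ε := by
    intro i ξ hξ
    obtain ⟨hre, hτlo, hτhi, -⟩ := hτfacts ξ hξ
    have hx := hxbound ξ hξ
    have hw1 : (1 + ‖wf ξ‖) ≤ 1 + W r := by linarith [hwbound ξ hξ]
    have hxfe : xf ξ = τf ξ • κc + wf ξ := rfl
    simp only [hGf]
    have hτpos' : 0 < ‖τf ξ‖ := by linarith
    have hden : 0 < ‖t i‖ * ‖τf ξ‖ ^ d i :=
      mul_pos (norm_pos_iff.mpr (ht0 i)) (pow_pos hτpos' _)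
    rw [norm_mul, norm_inv, norm_mul, norm_pow, ← div_eq_mul_inv, div_le_iff₀ hden]
    have e1 : ‖eval (xf ξ) (T i) - t i * τf ξ ^ d i‖ ≤
        CT i * (1 + W r) ^ NT i * 2 ^ d i * r ^ d i / r := by
      rw [hxfe]
      refine (norm_top_sub_le (T i) κc (hCT0 i) (hCT i) hr2 hτlo hτhi (wf ξ)).trans ?_
      refine div_le_div_of_nonneg_right ?_ hr0
      refine mul_le_mul_of_nonneg_right (mul_le_mul_of_nonneg_right ?_ (by positivity))
        (by positivity)
      exact mul_le_mul_of_nonneg_left (pow_le_pow_left₀ (by positivity) hw1 _) (hCT0 i)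
    set Sx : ℝ := ∑ m ∈ S i,
      CA i m * L ^ NA i m * ((1 + r) ^ NA i m * Real.exp (-(r / 12))) with hSx
    have hS0 : 0 ≤ Sx := Finset.sum_nonneg fun m _ =>
      mul_nonneg (mul_nonneg (hCA0 i m) (pow_nonneg hL0 _))
        (mul_nonneg (pow_nonneg (by linarith) _) (Real.exp_pos _).le)
    have e2 : ‖∑ m ∈ S i, eval (xf ξ) (A i m) * exp (((m : ℂ) - (ν i : ℂ)) * τf ξ)‖ ≤ Sx := by
      refine (norm_sum_le _ _).trans (Finset.sum_le_sum fun m hm => ?_)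
      have hlt : (m : ℝ) - (ν i : ℝ) ≤ -1 := by
        have := hS i m hm
        have : (m : ℝ) + 1 ≤ (ν i : ℝ) := by exact_mod_cast this
        linarith
      rw [norm_mul]
      have f1 : ‖eval (xf ξ) (A i m)‖ ≤ CA i m * L ^ NA i m * (1 + r) ^ NA i m := by
        refine (hCA i m (xf ξ)).trans ?_
        rw [mul_assoc, ← mul_pow]
        exact mul_le_mul_of_nonneg_left (pow_le_pow_left₀ (by positivity) hx _) (hCA0 i m)
      have f2 : ‖exp (((m : ℂ) - (ν i : ℂ)) * τf ξ)‖ ≤ Real.exp (-(r / 12)) := by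
        rw [Complex.norm_exp, Real.exp_le_exp]
        have hre' : (((m : ℂ) - (ν i : ℂ)) * τf ξ).re = ((m : ℝ) - (ν i : ℝ)) * (τf ξ).re := by
          simp [Complex.mul_re]
        rw [hre']
        have hτpos : 0 ≤ (τf ξ).re := by linarith
        nlinarith
      calc ‖eval (xf ξ) (A i m)‖ * ‖exp (((m : ℂ) - (ν i : ℂ)) * τf ξ)‖
          ≤ (CA i m * L ^ NA i m * (1 + r) ^ NA i m) * Real.exp (-(r / 12)) :=
            mul_le_mul f1 f2 (norm_nonneg _)
              (mul_nonneg (mul_nonneg (hCA0 i m) (pow_nonneg hL0 _)) (pow_nonneg (by linarith) _))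
        _ = CA i m * L ^ NA i m * ((1 + r) ^ NA i m * Real.exp (-(r / 12))) := by ring
    have hτd : (r / 2) ^ d i ≤ ‖τf ξ‖ ^ d i := pow_le_pow_left₀ (by positivity) hτlo _
    have hrd : 1 ≤ r ^ d i := one_le_pow₀ hr1
    have htn : 0 < ‖t i‖ := norm_pos_iff.mpr (ht0 i)
    have hFi : F i r * (‖t i‖ * (r / 2) ^ d i) =
        CT i * (1 + W r) ^ NT i * 2 ^ d i * r ^ d i / r + Sx * r ^ d i := by
      have h2r : (r / 2) ^ d i = r ^ d i / 2 ^ d i := div_pow r 2 (d i)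
      simp only [hF, hW]
      rw [← hSx, h2r]
      field_simp
      ring
    calc ‖eval (xf ξ) (T i) - t i * τf ξ ^ d i + ∑ m ∈ S i,
            eval (xf ξ) (A i m) * exp (((m : ℂ) - (ν i : ℂ)) * τf ξ)‖
        ≤ CT i * (1 + W r) ^ NT i * 2 ^ d i * r ^ d i / r + Sx :=
          (norm_add_le _ _).trans (add_le_add e1 e2)
      _ ≤ CT i * (1 + W r) ^ NT i * 2 ^ d i * r ^ d i / r + Sx * r ^ d i :=
          add_le_add le_rfl (le_mul_of_one_le_right hS0 hrd)
      _ = F i r * (‖t i‖ * (r / 2) ^ d i) := hFi.symm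
      _ ≤ ε * (‖t i‖ * (r / 2) ^ d i) :=
          mul_le_mul_of_nonneg_right (hFε i) (by positivity)
      _ ≤ ε * (‖t i‖ * ‖τf ξ‖ ^ d i) :=
          mul_le_mul_of_nonneg_left (mul_le_mul_of_nonneg_left hτd htn.le) hεpos.le
  have hGn12 : ∀ ξ ∈ ball (0 : Fin (s + 1) → ℂ) 1, ‖Gf (Fin.last s) ξ‖ ≤ 1 / 2 :=
    fun ξ hξ => (hGfb _ ξ hξ).trans hε12
  have hG_diff : ∀ j, DifferentiableOn ℂ (G j) (ball 0 1) := by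
    intro j
    refine Fin.lastCases ?_ (fun j => ?_) j
    · simp only [hG, Fin.snoc_last]
      intro ξ hξ
      have hlog : DifferentiableAt ℂ (fun ξ => log (1 + Gf (Fin.last s) ξ)) ξ :=
        (((hGf_diff _) ξ).const_add 1).clog
          (mem_slitPlane_of_norm_lt_one ((hGn12 ξ hξ).trans_lt (by norm_num)))
      have hE : DifferentiableAt ℂ Ef ξ :=
        (((hτf_diff.const_mul _).add ((hΛf_diff.const_mul _).add_const _)) ξ).add hlog
      exact (((((hτf_diff.pow D).const_mul α).sub (heval_diff g)) ξ |>.add hE).mul_const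
        K₀⁻¹).differentiableWithinAt
    · simp only [hG, Fin.snoc_castSucc]
      exact (hGf_diff _).differentiableOn
  have hbound : ∀ j, ∀ ξ ∈ ball (0 : Fin (s + 1) → ℂ) 1, ‖G j ξ‖ ≤ ε := by
    intro j ξ hξ
    refine Fin.lastCases ?_ (fun j => ?_) j
    · -- the base equation with the absorbed last fibre equation
      simp only [hG, Fin.snoc_last, hGl]
      obtain ⟨hre, hτlo, hτhi, -⟩ := hτfacts ξ hξ
      have hτ1 : 1 ≤ ‖τf ξ‖ := by linarith
      have hw1 : (1 + ‖wf ξ‖) ≤ 1 + W r := by linarith [hwbound ξ hξ]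
      have hxfe : xf ξ = τf ξ • κc + wf ξ := rfl
      rw [norm_mul, norm_inv, ← div_eq_mul_inv, div_le_iff₀ hK₀pos, hK₀norm']
      have e1 : ‖α * τf ξ ^ D - eval (xf ξ) g‖ ≤ Cg * (1 + W r) ^ Ng * (2 * r) ^ (D - 1) := by
        rw [show α * τf ξ ^ D - eval (xf ξ) g = -(eval (xf ξ) g - τf ξ ^ D * α) by ring, norm_neg,
          hxfe]
        refine (hCg (τf ξ) hτ1 (wf ξ)).trans ?_
        exact mul_le_mul (mul_le_mul_of_nonneg_left (pow_le_pow_left₀ (by positivity) hw1 _) hCg0)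
          (pow_le_pow_left₀ (norm_nonneg _) hτhi _) (by positivity) (by positivity)
      have e2 : ‖Ef ξ‖ ≤ 2 * νn * r + W r + 1 := by
        simp only [hEf]
        have f1 : ‖(ν (Fin.last s) : ℂ) * τf ξ‖ ≤ νn * (2 * r) := by
          rw [norm_mul, Complex.norm_intCast, hνn]
          exact mul_le_mul_of_nonneg_left hτhi (abs_nonneg _)
        have f2 : ‖(d (Fin.last s) : ℂ) * Λf ξ + ℓ (Fin.last s)‖ ≤ W r := by
          simpa using hwj ξ hξ (Fin.last s) 0 (by simp)
        have f3 : ‖log (1 + Gf (Fin.last s) ξ)‖ ≤ 1 :=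
          (Complex.norm_log_one_add_half_le_self (hGn12 ξ hξ)).trans (by linarith [hGn12 ξ hξ])
        calc _ ≤ ‖(ν (Fin.last s) : ℂ) * τf ξ‖ + ‖(d (Fin.last s) : ℂ) * Λf ξ + ℓ (Fin.last s)‖ +
              ‖log (1 + Gf (Fin.last s) ξ)‖ := norm_add₃_le
          _ ≤ _ := by linarith
      obtain ⟨D', hD'⟩ : ∃ D', D = D' + 2 := ⟨D - 2, by omega⟩
      have hDm : D - 1 = D' + 1 := by omega
      have hrpow : r ≤ r ^ (D' + 1) := by
        calc r = r ^ 1 := (pow_one r).symm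
          _ ≤ r ^ (D' + 1) := pow_le_pow_right₀ hr1 (by omega)
      have hFlr : Fl r * (‖α‖ * r ^ D) = (2 * νn + 1) * (1 + W r) * r ^ (D' + 1) +
          Cg * (1 + W r) ^ Ng * (2 ^ (D' + 1) * r ^ (D' + 1)) := by
        simp only [hFl, hW]
        rw [hDm, hD', pow_one]
        field_simp
        ring
      have hνn0 : 0 ≤ νn := abs_nonneg _
      have key : 2 * νn * r + W r + 1 ≤ (2 * νn + 1) * (1 + W r) * r ^ (D' + 1) := by
        have h1 : (2 * νn + 1) * (1 + W r) * r ≤ (2 * νn + 1) * (1 + W r) * r ^ (D' + 1) :=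
          mul_le_mul_of_nonneg_left hrpow (by positivity)
        nlinarith [hW0, mul_nonneg hνn0 hW0, mul_nonneg hνn0 hr0, mul_nonneg hW0 hr0]
      calc ‖α * τf ξ ^ D - eval (xf ξ) g + Ef ξ‖
          ≤ Cg * (1 + W r) ^ Ng * (2 * r) ^ (D - 1) + (2 * νn * r + W r + 1) :=
            (norm_add_le _ _).trans (add_le_add e1 e2)
        _ ≤ Fl r * (‖α‖ * r ^ D) := by rw [hFlr, hDm, mul_pow]; linarith
        _ ≤ ε * (‖α‖ * r ^ D) := mul_le_mul_of_nonneg_right hFlε (by positivity)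
    · simp only [hG, Fin.snoc_castSucc]
      exact hGfb _ ξ hξ
  have hε' : 16 * ((s + 1 : ℕ) + 1 : ℝ) * ε ≤ 1 := by
    rw [hε]; push_cast
    have : (16 : ℝ) * (s + 1 + 1) * (1 / (16 * (s + 2))) = 1 := by field_simp; ring
    rw [this]
  obtain ⟨ξ, hξ, hfix⟩ :=
    Literature.NumberTheory.Transcendental.ExpDominant.exists_exp_eq_one_add G hεpos.le hε'
      hG_diff hbound
  have hξball : ξ ∈ ball (0 : Fin (s + 1) → ℂ) 1 := by
    rw [mem_ball, dist_zero_right]; linarith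
  set τ := τf ξ with hτdef
  set x := xf ξ with hxdef
  -- the fibre identity, for every `i`, from `e^{z} = 1 + Gf i ξ`
  have hfibre : ∀ i (z : ℂ), exp z = 1 + Gf i ξ →
      t i * τ ^ d i * exp z = eval x (T i) +
        ∑ m ∈ S i, eval x (A i m) * exp (((m : ℂ) - (ν i : ℂ)) * τ) := by
    intro i z hz
    refine mul_exp_eq_of_exp_eq (mul_ne_zero (ht0 i) (pow_ne_zero _ (hτf_ne ξ))) ?_
    rw [hz]; simp only [hGf, ← hτdef, ← hxdef]; ring
  have hassemble : ∀ i, exp ((ν i : ℂ) * τ) * (eval x (T i) +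
      ∑ m ∈ S i, eval x (A i m) * exp (((m : ℂ) - (ν i : ℂ)) * τ)) =
        eval x (T i) * exp ((ν i : ℂ) * τ) + ∑ m ∈ S i, eval x (A i m) * exp ((m : ℂ) * τ) :=
    fun i => exp_mul_fibreSum (ν i) τ _ (S i) fun m => eval x (A i m)
  have hτpowd : ∀ i, exp ((d i : ℂ) * Λf ξ) = τ ^ d i := fun i => by
    rw [Complex.exp_nat_mul, hτdef]
  refine ⟨x, τ, fun i => ?_⟩
  refine Fin.lastCases ?_ (fun j => ?_) i
  · rw [Fin.snoc_last]
    have hτD : α * τ ^ D = K₀ * exp (ξ (Fin.last s)) := by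
      have e : τ ^ D = τ₀ ^ D * exp (ξ (Fin.last s)) := by
        have hDi : (D : ℂ) * (ξ (Fin.last s) * (D : ℂ)⁻¹) = ξ (Fin.last s) := by field_simp
        rw [hτdef]
        simp only [hτf, hΛf, hτ₀, mul_pow, ← Complex.exp_nat_mul, hDi, Complex.exp_add,
          Complex.ofReal_log hr0, Complex.exp_log (by exact_mod_cast hrpos.ne' : (r : ℂ) ≠ 0)]
      rw [e, ← mul_assoc, hK₀eq]
    have hlast := hfix (Fin.last s)
    simp only [hG, Fin.snoc_last, hGl, ← hτdef, ← hxdef] at hlast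
    have hu : eval x g = K₀ + Ef ξ := by
      have hKt : ∀ z : ℂ, K₀ * (z * K₀⁻¹) = z := fun z => by field_simp
      have h1 : K₀ * exp (ξ (Fin.last s)) = K₀ + (α * τ ^ D - eval x g + Ef ξ) := by
        rw [hlast, mul_add, mul_one, hKt]
      rw [← hτD] at h1
      linear_combination h1
    have hG1 : 1 + Gf (Fin.last s) ξ ≠ 0 := by
      intro h0
      have := hGn12 ξ hξball
      have h1 : ‖Gf (Fin.last s) ξ‖ = 1 := by
        rw [show Gf (Fin.last s) ξ = -1 by linear_combination h0]; simp
      linarith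
    rw [hu, Complex.exp_add, hexpK₀, one_mul]
    simp only [hEf, ← hτdef]
    rw [Complex.exp_add, Complex.exp_add, Complex.exp_add, hτpowd, hexpℓ,
      mul_comm (τ ^ d (Fin.last s)) (t (Fin.last s)), mul_assoc,
      hfibre (Fin.last s) (log (1 + Gf (Fin.last s) ξ)) (Complex.exp_log hG1)]
    exact hassemble _
  · rw [Fin.snoc_castSucc]
    have hj := hfix (Fin.castSucc j)
    simp only [hG, Fin.snoc_castSucc] at hj
    have hxj : x j = τ * κc j + ((d (Fin.castSucc j) : ℂ) * Λf ξ + ℓ (Fin.castSucc j) +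
        ξ (Fin.castSucc j)) := by
      rw [hxdef, hτdef]
      simp only [hxf, hwf, Pi.add_apply, Pi.smul_apply, smul_eq_mul]
    rw [hxj, Complex.exp_add, Complex.exp_add, Complex.exp_add, hτpowd, hexpℓ,
      mul_comm (τ ^ d (Fin.castSucc j)) (t (Fin.castSucc j)), hfibre (Fin.castSucc j) _ hj]
    simp only [hκc]
    rw [mul_comm τ ((ν (Fin.castSucc j) : ℂ))]
    exact hassemble _

end Summit.Schanuel.Schanuel.Theorems
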